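import Summits.Ventures.CertifiedManyBodySolver.Observables.SourcedGibbsTrialCapKSpaceExpect
import Summits.Ventures.CertifiedManyBodySolver.Observables.SourcedGibbsTrialCapKSpaceRiemannDensity
import Summits.Ventures.CertifiedManyBodySolver.Observables.PinningFieldSqrtTwoGridReaders
import Summits.Ventures.CertifiedManyBodySolver.Observables.TISourcedMinimiserChordFloorExact
import Literature.MathematicalPhysics.QuantumLattice.PairSourcedTorusGibbsTrialStateMixing
import HarnessLib

/-!
# The HF–BCS sourced cap in the CANONICAL (fixed-density) CLASS of the thermodynamic limit, and the canonical-class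
# finite-field response FLOOR it feeds: certified `#`-row floor × two HF–BCS grids mixed to density EXACTLY `n`

Cell hubbard-obs (D-0082 / HORIZON-BREAK §9.1; row «pinning-field response menu nodes — Hellmann–Feynman brackets from
certified e₀(h ± δh)», seat hubbard-obs-pin-2). HONEST FRAMING: zero compute; implications only; the certified momentum
sums enter as HYPOTHESES (`hsᵢ haᵢ hbᵢ`: two-engine interval tables, kit jobs of the cell); a floor is CONDITIONAL on a
named registry row (`hlo`); large-field RESPONSE floors on infinite-volume fixed-density ground states — never an
order parameter, no `h → 0` content, no phase sentence, not a superconductivity verdict.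

The chain. (i) Files I–VIII (`SourcedGibbsTrialCap*`): the free `d`-wave pinned Gibbs state `e^{−βA_L(0,μ',h)}/Z` has
number per site `n_L = L⁻²Σ_k(1 − ξ_k t_k/E_k)` and sourced energy per site
`L⁻²Re⟨A_L(U,0,h)⟩ = −L⁻²Σ_k E_k t_k − μ' + μ'n_L + U n_L²/4` (Hartree term; on-site anomalous amplitude zero);
(ii) files V–VI: both momentum sums per site are `2πK(1/L + 1/L₁)`-close between any two grids (Davis–Rabinowitz via the
tree's Lipschitz Riemann-sum lemma), so ONE certified grid `L₁` controls every `L ≥ L₁` with vanishing slack;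
(iii) `Literature/…/PairSourcedTorusGibbsTrialState{Limit,Mixing}`: such Gibbs families have translation-invariant
torus limits with density in the certified box and the Hartree-shaped energy cap, and TWO families bracketing `n` mix in
infinite volume to density EXACTLY `n` under four corner conditions (separately convex defect);
(iv) hubbard-cq's `re_expect_localPairAt_ge_of_minimiser` (`TISourcedMinimiserChordFloorExact`): a certified canonical
floor `lo ≤ e(1,0,U,n)` and a density-`n` cap `u` at field `h` give `(lo − u)/(2h) ≤ Re ω(P₀^d)` for every
translation-invariant density-`n` minimiser `ω` of `E_h`.

* §1 `hfbcs_gibbs_rows_of_grid` — one family: certified grid data ⇒ the bridge's interval rows on every `L ≥ L₁`.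
* §2 `exists_canonicalClass_sourced_le_of_two_HFBCS_grids` — two families ⇒ `hcap` at density EXACTLY `n` (general `h`).
* §3 `exists_canonicalClass_sourced_le_of_two_HFBCS_sqrtTwoMul_grids` — grid field `h = √2 g`: rational gap
  coefficient, `π`-free slack tests (`π < 3.141593`), all side conditions decidable in `ℚ`.
* §4 `re_expect_localPairAt_ge_of_minimiser_of_two_HFBCS_sqrtTwoMul_grids` (+ rational-slot form) — the floor leaf
  shape: registry floor node × certified sums × `norm_num`.

References: Bach–Lieb–Solovej (1994) §2 [BachLiebSolovej1994]; Davis–Rabinowitz (1984) §2.1 [DavisRabinowitz1984];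
Bratteli–Robinson I §4.3.1 [BratteliRobinsonI1987]; Griffiths, Phys. Rev. 152 (1966) 240 §II [Griffiths1966];
Koma–Tasaki, J. Stat. Phys. 76 (1994) 745 §1 [KomaTasaki1994]; Ruelle (1969) §3.4 [Ruelle1969].
-/

noncomputable section

open Real Finset Matrix Literature.MathematicalPhysics.QuantumLattice Literature.Probability.LatticeModels
open Literature.MathematicalPhysics.QuantumLattice.HubbardWave0 Literature.MathematicalPhysics.QuantumLattice.ThermodynamicLimit
open Summit.Ventures.CertifiedManyBodySolver

namespace Summit.Ventures.CertifiedManyBodySolver.Observables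

/-! ### §1 One HF–BCS Gibbs family: the interval rows of the mixture bridge from ONE certified grid -/

section Rows

/-- **HF–BCS Gibbs family rows from one grid** (`L₁ ≥ 3`, `β ≥ 0`, any `U μ' h`). If the `L₁`-grid momentum sums of
the free `d`-wave pinned Gibbs state at `(μ', β, h)` satisfy `s ≤ L₁⁻²Σ_k E_k t_k` and `a ≤ L₁⁻²Σ_k(1 − ξ_k t_k/E_k) ≤ b`
(certified interval numerics), and `δ ≥ C₂/L₁`, `ε ≥ C₁/L₁` (`C₁ = 2π(3/2)(2 + 2√2|h|)`, `C₂ = 2πβ(3 + 2√2|h|)`, the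
two-grid Davis–Rabinowitz constants of files V–VI), then on EVERY torus `L ≥ L₁` the Gibbs state of the Hermitian
trial matrix `B = A_L(0, μ', h)` has number per site `n_L ∈ [a − δ − c/L, b + δ + c/L]` and sourced energy per site
`Re⟨A_L(U,0,h)⟩/L² ≤ (−s + ε − μ') + μ'·n_L + U·n_L²/4 + c/L` with `c = C₁ + C₂` — the `hrows` shape of
`exists_isTranslationInvariant_density_eq_meanEnergy_sourced_le_of_two_gibbs_families`.
[cite: DavisRabinowitz1984, §2.1 eq. (2.1.6)] [cite: BachLiebSolovej1994, §2] -/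
theorem hfbcs_gibbs_rows_of_grid (L₁ : ℕ) [NeZero L₁] (hL₁ : 3 ≤ L₁) (U μ' h β : ℝ) (hβ : 0 ≤ β)
    {s a b δ ε : ℝ}
    (hs : s ≤ (∑ k : TorusSite 2 L₁, Real.sqrt ((torusBand L₁ k - μ') ^ 2 + (2 * Real.sqrt 2 * h * dWaveGap k) ^ 2) * Real.tanh (β * Real.sqrt ((torusBand L₁ k - μ') ^ 2 + (2 * Real.sqrt 2 * h * dWaveGap k) ^ 2) / 2)) / (L₁ : ℝ) ^ 2)
    (ha : a ≤ (∑ k : TorusSite 2 L₁, (1 - (torusBand L₁ k - μ') * Real.tanh (β * Real.sqrt ((torusBand L₁ k - μ') ^ 2 + (2 * Real.sqrt 2 * h * dWaveGap k) ^ 2) / 2) / Real.sqrt ((torusBand L₁ k - μ') ^ 2 + (2 * Real.sqrt 2 * h * dWaveGap k) ^ 2))) / (L₁ : ℝ) ^ 2)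
    (hb : (∑ k : TorusSite 2 L₁, (1 - (torusBand L₁ k - μ') * Real.tanh (β * Real.sqrt ((torusBand L₁ k - μ') ^ 2 + (2 * Real.sqrt 2 * h * dWaveGap k) ^ 2) / 2) / Real.sqrt ((torusBand L₁ k - μ') ^ 2 + (2 * Real.sqrt 2 * h * dWaveGap k) ^ 2))) / (L₁ : ℝ) ^ 2 ≤ b)
    (hδ : (2 * π * (β * (3 + 2 * Real.sqrt 2 * |h|))) / (L₁ : ℝ) ≤ δ) (hε : (2 * π * (3 / 2 * (2 + 2 * Real.sqrt 2 * |h|))) / (L₁ : ℝ) ≤ ε) :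
    ∀ L : ℕ, L₁ ≤ L → ∀ [NeZero L],
      ∃ B : Matrix (Finset (Orb (FermionTorus 2 L))) (Finset (Orb (FermionTorus 2 L))) ℂ, B.IsHermitian ∧
        (a - δ) - ((2 * π * (3 / 2 * (2 + 2 * Real.sqrt 2 * |h|))) + (2 * π * (β * (3 + 2 * Real.sqrt 2 * |h|)))) / (L : ℝ) ≤ (gibbsState β B totalNumber).re / (L : ℝ) ^ 2 ∧
        (gibbsState β B totalNumber).re / (L : ℝ) ^ 2 ≤ (b + δ) + ((2 * π * (3 / 2 * (2 + 2 * Real.sqrt 2 * |h|))) + (2 * π * (β * (3 + 2 * Real.sqrt 2 * |h|)))) / (L : ℝ) ∧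
        (gibbsState β B (dWaveSourceTorusTT' L 0 U 0 h)).re / (L : ℝ) ^ 2 ≤
          (-s + ε - μ') + μ' * ((gibbsState β B totalNumber).re / (L : ℝ) ^ 2) +
            U * ((gibbsState β B totalNumber).re / (L : ℝ) ^ 2) ^ 2 / 4 + ((2 * π * (3 / 2 * (2 + 2 * Real.sqrt 2 * |h|))) + (2 * π * (β * (3 + 2 * Real.sqrt 2 * |h|)))) / (L : ℝ) := by
  intro L hLL _
  have hL3 : 3 ≤ L := hL₁.trans hLL
  have hLpos : (0 : ℝ) < (L : ℝ) := Nat.cast_pos.2 (by omega)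
  have hL₁pos : (0 : ℝ) < (L₁ : ℝ) := Nat.cast_pos.2 (by omega)
  have hL2 : (0 : ℝ) < (L : ℝ) ^ 2 := by positivity
  have hC1 : (0 : ℝ) ≤ (2 * π * (3 / 2 * (2 + 2 * Real.sqrt 2 * |h|))) := by positivity
  have hC2 : (0 : ℝ) ≤ (2 * π * (β * (3 + 2 * Real.sqrt 2 * |h|))) := by positivity
  refine ⟨dWaveSourceTorus L 0 μ' h, dWaveSourceTorus_isHermitian L (isHermitian_hubbardTorusWith L 1 0 μ') h, ?_⟩
  -- the two expectation rows in momentum space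
  rw [dWaveSourceTorusTT'_zero_tp, re_gibbsState_dWaveSourceTorus_totalNumber_eq_kSpace hL3 μ' h β,
    re_gibbsState_dWaveSourceTorus_eq_kSpace' hL3 U 0 μ' h β]
  -- the two-grid controls between `L` and `L₁`
  have key2 := abs_bdgEnergyTanh_density_two_grid_le L L₁ β μ' h
  have key3 := abs_bdgDensity_two_grid_le L L₁ hβ μ' h
  generalize hA : (∑ k : TorusSite 2 L, Real.sqrt ((torusBand L k - μ') ^ 2 + (2 * Real.sqrt 2 * h * dWaveGap k) ^ 2) * Real.tanh (β * Real.sqrt ((torusBand L k - μ') ^ 2 + (2 * Real.sqrt 2 * h * dWaveGap k) ^ 2) / 2)) = A at key2 ⊢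
  generalize hB : (∑ k : TorusSite 2 L, (1 - (torusBand L k - μ') * Real.tanh (β * Real.sqrt ((torusBand L k - μ') ^ 2 + (2 * Real.sqrt 2 * h * dWaveGap k) ^ 2) / 2) / Real.sqrt ((torusBand L k - μ') ^ 2 + (2 * Real.sqrt 2 * h * dWaveGap k) ^ 2))) = B at key3 ⊢
  generalize hA₁ : (∑ k : TorusSite 2 L₁, Real.sqrt ((torusBand L₁ k - μ') ^ 2 + (2 * Real.sqrt 2 * h * dWaveGap k) ^ 2) * Real.tanh (β * Real.sqrt ((torusBand L₁ k - μ') ^ 2 + (2 * Real.sqrt 2 * h * dWaveGap k) ^ 2) / 2)) = A₁ at key2 hs ⊢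
  generalize hB₁ : (∑ k : TorusSite 2 L₁, (1 - (torusBand L₁ k - μ') * Real.tanh (β * Real.sqrt ((torusBand L₁ k - μ') ^ 2 + (2 * Real.sqrt 2 * h * dWaveGap k) ^ 2) / 2) / Real.sqrt ((torusBand L₁ k - μ') ^ 2 + (2 * Real.sqrt 2 * h * dWaveGap k) ^ 2))) = B₁ at key3 ha hb ⊢
  generalize hc1 : (2 * π * (3 / 2 * (2 + 2 * Real.sqrt 2 * |h|))) = c₁ at key2 hC1 hε ⊢
  generalize hc2 : (2 * π * (β * (3 + 2 * Real.sqrt 2 * |h|))) = c₂ at key3 hC2 hδ ⊢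
  -- slack bookkeeping: `cᵢ(1/L + 1/L₁) ≤ (slack at L₁) + (c₁ + c₂)/L`
  have h1L : 0 < 1 / (L : ℝ) := by positivity
  have hs' : s - ε - (c₁ + c₂) / (L : ℝ) ≤ A / (L : ℝ) ^ 2 := by
    have := neg_abs_le (A / (L : ℝ) ^ 2 - A₁ / (L₁ : ℝ) ^ 2)
    have e1 : c₁ * (1 / (L : ℝ) + 1 / (L₁ : ℝ)) = c₁ / (L : ℝ) + c₁ / (L₁ : ℝ) := by ring
    have e2 : (c₁ + c₂) / (L : ℝ) = c₁ / (L : ℝ) + c₂ / (L : ℝ) := by ring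
    have hc2L : 0 ≤ c₂ / (L : ℝ) := div_nonneg hC2 hLpos.le
    linarith
  have hnlo : (a - δ) - (c₁ + c₂) / (L : ℝ) ≤ B / (L : ℝ) ^ 2 := by
    have := neg_abs_le (B / (L : ℝ) ^ 2 - B₁ / (L₁ : ℝ) ^ 2)
    have e1 : c₂ * (1 / (L : ℝ) + 1 / (L₁ : ℝ)) = c₂ / (L : ℝ) + c₂ / (L₁ : ℝ) := by ring
    have e2 : (c₁ + c₂) / (L : ℝ) = c₁ / (L : ℝ) + c₂ / (L : ℝ) := by ring
    have hc1L : 0 ≤ c₁ / (L : ℝ) := div_nonneg hC1 hLpos.le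
    linarith
  have hnhi : B / (L : ℝ) ^ 2 ≤ (b + δ) + (c₁ + c₂) / (L : ℝ) := by
    have := le_abs_self (B / (L : ℝ) ^ 2 - B₁ / (L₁ : ℝ) ^ 2)
    have e1 : c₂ * (1 / (L : ℝ) + 1 / (L₁ : ℝ)) = c₂ / (L : ℝ) + c₂ / (L₁ : ℝ) := by ring
    have e2 : (c₁ + c₂) / (L : ℝ) = c₁ / (L : ℝ) + c₂ / (L : ℝ) := by ring
    have hc1L : 0 ≤ c₁ / (L : ℝ) := div_nonneg hC1 hLpos.le
    linarith
  refine ⟨hnlo, hnhi, ?_⟩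
  -- the energy row: `e_L = −A/L² − μ' + μ'·(B/L²) + U (B/L²)²/4`
  have hid : ((-A - μ' * (L : ℝ) ^ 2) + (μ' - 0) * B + U * ((L : ℝ) ^ 2 * (B / (2 * (L : ℝ) ^ 2)) ^ 2)) / (L : ℝ) ^ 2 =
      -(A / (L : ℝ) ^ 2) - μ' + μ' * (B / (L : ℝ) ^ 2) + U * (B / (L : ℝ) ^ 2) ^ 2 / 4 := by
    field_simp
    ring
  rw [hid]
  linarith

end Rows

/-! ### §2 Two families bracketing the density: the canonical-class HF–BCS cap in the thermodynamic limit -/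

section Assembly

/-- **THE CANONICAL-CLASS HF–BCS CAP FROM TWO CERTIFIED GRIDS** (`t' = 0`, `U ≥ 0`, `L₁ ≥ 3`, `βᵢ ≥ 0`). Two free
`d`-wave pinned Gibbs families at trial chemical potentials `μ'₁, μ'₂` (inverse temperatures `β₁, β₂`, same field `h`)
with certified `L₁`-grid data `sᵢ ≤ L₁⁻²Σ E t`, `aᵢ ≤ L₁⁻²Σ(1 − ξt/E) ≤ bᵢ`, slack bounds `δᵢ ≥ C₂ⁱ/L₁`, `ε ≥ C₁/L₁`,
whose limit-density boxes bracket `n` — `b₁ + δ₁ < n < a₂ − δ₂` — and the FOUR CORNER conditions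
`(d₂ − n)·q₁(d₁) + (n − d₁)·q₂(d₂) ≤ u·(d₂ − d₁)`, `dᵢ ∈ {aᵢ − δᵢ, bᵢ + δᵢ}`, `qᵢ(d) = (−sᵢ + ε − μ'ᵢ) + μ'ᵢ d + U d²/4`:
SOME translation-invariant state of density EXACTLY `n` has sourced mean energy `e^{src}_h ≤ u`
(`hubbardTTPrimeSourcedInteraction 1 0 U 0 dWaveFormFactor h`, the `μ = 0` pencil) — the hypothesis `hcap` of
`re_expect_localPairAt_ge_of_minimiser`, from the mixture bridge (`Literature/…/PairSourcedTorusGibbsTrialStateMixing`).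
[cite: BachLiebSolovej1994, §2] [cite: BratteliRobinsonI1987, §4.3.1] [cite: DavisRabinowitz1984, §2.1 eq. (2.1.6)] -/
theorem exists_canonicalClass_sourced_le_of_two_HFBCS_grids (L₁ : ℕ) [NeZero L₁] (hL₁ : 3 ≤ L₁) {U : ℝ}
    (hU : 0 ≤ U) (h μ'₁ β₁ μ'₂ β₂ : ℝ) (hβ₁ : 0 ≤ β₁) (hβ₂ : 0 ≤ β₂)
    {s₁ a₁ b₁ δ₁ s₂ a₂ b₂ δ₂ ε n u : ℝ}
    (hs₁ : s₁ ≤ (∑ k : TorusSite 2 L₁, Real.sqrt ((torusBand L₁ k - μ'₁) ^ 2 + (2 * Real.sqrt 2 * h * dWaveGap k) ^ 2) * Real.tanh (β₁ * Real.sqrt ((torusBand L₁ k - μ'₁) ^ 2 + (2 * Real.sqrt 2 * h * dWaveGap k) ^ 2) / 2)) / (L₁ : ℝ) ^ 2)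
    (ha₁ : a₁ ≤ (∑ k : TorusSite 2 L₁, (1 - (torusBand L₁ k - μ'₁) * Real.tanh (β₁ * Real.sqrt ((torusBand L₁ k - μ'₁) ^ 2 + (2 * Real.sqrt 2 * h * dWaveGap k) ^ 2) / 2) / Real.sqrt ((torusBand L₁ k - μ'₁) ^ 2 + (2 * Real.sqrt 2 * h * dWaveGap k) ^ 2))) / (L₁ : ℝ) ^ 2)
    (hb₁ : (∑ k : TorusSite 2 L₁, (1 - (torusBand L₁ k - μ'₁) * Real.tanh (β₁ * Real.sqrt ((torusBand L₁ k - μ'₁) ^ 2 + (2 * Real.sqrt 2 * h * dWaveGap k) ^ 2) / 2) / Real.sqrt ((torusBand L₁ k - μ'₁) ^ 2 + (2 * Real.sqrt 2 * h * dWaveGap k) ^ 2))) / (L₁ : ℝ) ^ 2 ≤ b₁)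
    (hδ₁ : (2 * π * (β₁ * (3 + 2 * Real.sqrt 2 * |h|))) / (L₁ : ℝ) ≤ δ₁)
    (hs₂ : s₂ ≤ (∑ k : TorusSite 2 L₁, Real.sqrt ((torusBand L₁ k - μ'₂) ^ 2 + (2 * Real.sqrt 2 * h * dWaveGap k) ^ 2) * Real.tanh (β₂ * Real.sqrt ((torusBand L₁ k - μ'₂) ^ 2 + (2 * Real.sqrt 2 * h * dWaveGap k) ^ 2) / 2)) / (L₁ : ℝ) ^ 2)
    (ha₂ : a₂ ≤ (∑ k : TorusSite 2 L₁, (1 - (torusBand L₁ k - μ'₂) * Real.tanh (β₂ * Real.sqrt ((torusBand L₁ k - μ'₂) ^ 2 + (2 * Real.sqrt 2 * h * dWaveGap k) ^ 2) / 2) / Real.sqrt ((torusBand L₁ k - μ'₂) ^ 2 + (2 * Real.sqrt 2 * h * dWaveGap k) ^ 2))) / (L₁ : ℝ) ^ 2)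
    (hb₂ : (∑ k : TorusSite 2 L₁, (1 - (torusBand L₁ k - μ'₂) * Real.tanh (β₂ * Real.sqrt ((torusBand L₁ k - μ'₂) ^ 2 + (2 * Real.sqrt 2 * h * dWaveGap k) ^ 2) / 2) / Real.sqrt ((torusBand L₁ k - μ'₂) ^ 2 + (2 * Real.sqrt 2 * h * dWaveGap k) ^ 2))) / (L₁ : ℝ) ^ 2 ≤ b₂)
    (hδ₂ : (2 * π * (β₂ * (3 + 2 * Real.sqrt 2 * |h|))) / (L₁ : ℝ) ≤ δ₂)
    (hε : (2 * π * (3 / 2 * (2 + 2 * Real.sqrt 2 * |h|))) / (L₁ : ℝ) ≤ ε)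
    (hlt : b₁ + δ₁ < n) (hgt : n < a₂ - δ₂)
    (hcaa : ((a₂ - δ₂) - n) * ((-s₁ + ε - μ'₁) + μ'₁ * (a₁ - δ₁) + U * (a₁ - δ₁) ^ 2 / 4) +
      (n - (a₁ - δ₁)) * ((-s₂ + ε - μ'₂) + μ'₂ * (a₂ - δ₂) + U * (a₂ - δ₂) ^ 2 / 4) ≤ u * ((a₂ - δ₂) - (a₁ - δ₁)))
    (hcab : ((b₂ + δ₂) - n) * ((-s₁ + ε - μ'₁) + μ'₁ * (a₁ - δ₁) + U * (a₁ - δ₁) ^ 2 / 4) +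
      (n - (a₁ - δ₁)) * ((-s₂ + ε - μ'₂) + μ'₂ * (b₂ + δ₂) + U * (b₂ + δ₂) ^ 2 / 4) ≤ u * ((b₂ + δ₂) - (a₁ - δ₁)))
    (hcba : ((a₂ - δ₂) - n) * ((-s₁ + ε - μ'₁) + μ'₁ * (b₁ + δ₁) + U * (b₁ + δ₁) ^ 2 / 4) +
      (n - (b₁ + δ₁)) * ((-s₂ + ε - μ'₂) + μ'₂ * (a₂ - δ₂) + U * (a₂ - δ₂) ^ 2 / 4) ≤ u * ((a₂ - δ₂) - (b₁ + δ₁)))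
    (hcbb : ((b₂ + δ₂) - n) * ((-s₁ + ε - μ'₁) + μ'₁ * (b₁ + δ₁) + U * (b₁ + δ₁) ^ 2 / 4) +
      (n - (b₁ + δ₁)) * ((-s₂ + ε - μ'₂) + μ'₂ * (b₂ + δ₂) + U * (b₂ + δ₂) ^ 2 / 4) ≤ u * ((b₂ + δ₂) - (b₁ + δ₁))) :
    ∃ σ : InfVolFermionState 2, σ.IsTranslationInvariant ∧ σ.density = n ∧
      σ.meanEnergy (hubbardTTPrimeSourcedInteraction 1 0 U 0 dWaveFormFactor h) 1 ≤ u :=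
  exists_isTranslationInvariant_density_eq_meanEnergy_sourced_le_of_two_gibbs_families 0 U 0 h β₁ β₂ L₁ L₁ hU
    (hfbcs_gibbs_rows_of_grid L₁ hL₁ U μ'₁ h β₁ hβ₁ hs₁ ha₁ hb₁ hδ₁ hε)
    (hfbcs_gibbs_rows_of_grid L₁ hL₁ U μ'₂ h β₂ hβ₂ hs₂ ha₂ hb₂ hδ₂ hε)
    hlt hgt hcaa hcab hcba hcbb

end Assembly

/-! ### §3 At grid fields `h = √2·g`: everything rational except the certified momentum sums -/

section SqrtTwoGrid

/-- `π`-free slack test at a grid field: for rationals `g ≥ 0`, `β ≥ 0`, `L₁ > 0`, if `2·3.141593·β(3 + 4g) ≤ δ·L₁` then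
`C₂/L₁ = 2πβ(3 + 2√2|√2 g|)/L₁ ≤ δ` (`π < 3.141593`, Mathlib `Real.pi_lt_d6`). [folklore] -/
private theorem density_slack_le_of_rat (L₁ : ℕ) [NeZero L₁] {g β δ : ℚ} (hg : 0 ≤ g) (hβ : 0 ≤ β)
    (hδ : 2 * (3141593 / 10 ^ 6 : ℚ) * (β * (3 + 4 * g)) ≤ δ * L₁) :
    (2 * π * (((β : ℚ) : ℝ) * (3 + 2 * Real.sqrt 2 * |Real.sqrt 2 * (g : ℝ)|))) / (L₁ : ℝ) ≤ ((δ : ℚ) : ℝ) := by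
  have hL : (0 : ℝ) < (L₁ : ℝ) := Nat.cast_pos.2 (Nat.pos_of_ne_zero (NeZero.ne L₁))
  have hg' : (0 : ℝ) ≤ (g : ℝ) := by exact_mod_cast hg
  have hβ' : (0 : ℝ) ≤ (β : ℝ) := by exact_mod_cast hβ
  rw [two_mul_sqrt_two_mul_abs_sqrt_two_mul hg', div_le_iff₀ hL]
  have hδ' : (((2 * (3141593 / 10 ^ 6 : ℚ) * (β * (3 + 4 * g)) : ℚ)) : ℝ) ≤ (((δ * L₁ : ℚ)) : ℝ) := Rat.cast_le.2 hδ
  push_cast at hδ'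
  have hπ := Real.pi_lt_d6
  have hm : 0 ≤ (β : ℝ) * (3 + 4 * (g : ℝ)) := by positivity
  nlinarith

/-- `π`-free energy slack test: if `2·3.141593·(3/2)(2 + 4g) ≤ ε·L₁` then `C₁/L₁ ≤ ε`. [folklore] -/
private theorem energy_slack_le_of_rat (L₁ : ℕ) [NeZero L₁] {g ε : ℚ} (hg : 0 ≤ g)
    (hε : 2 * (3141593 / 10 ^ 6 : ℚ) * (3 / 2 * (2 + 4 * g)) ≤ ε * L₁) :
    (2 * π * (3 / 2 * (2 + 2 * Real.sqrt 2 * |Real.sqrt 2 * (g : ℝ)|))) / (L₁ : ℝ) ≤ ((ε : ℚ) : ℝ) := by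
  have hL : (0 : ℝ) < (L₁ : ℝ) := Nat.cast_pos.2 (Nat.pos_of_ne_zero (NeZero.ne L₁))
  have hg' : (0 : ℝ) ≤ (g : ℝ) := by exact_mod_cast hg
  rw [two_mul_sqrt_two_mul_abs_sqrt_two_mul hg', div_le_iff₀ hL]
  have hε' : (((2 * (3141593 / 10 ^ 6 : ℚ) * (3 / 2 * (2 + 4 * g)) : ℚ)) : ℝ) ≤ (((ε * L₁ : ℚ)) : ℝ) := Rat.cast_le.2 hε
  push_cast at hε'
  have hπ := Real.pi_lt_d6
  have hm : 0 ≤ (3 / 2 : ℝ) * (2 + 4 * (g : ℝ)) := by positivity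
  nlinarith

/-- **THE CANONICAL-CLASS HF–BCS CAP AT A GRID FIELD `h = √2·g`, RATIONAL SLOTS** (`t' = 0`): the momentum sums carry
the rational gap coefficient `(2√2h)² = 16g²` (exactly the `S1`, `n` columns the cell's two-engine interval tables
certify per `(L₁, β, μ', g)`), the Lipschitz slacks are tested against `π < 3.141593`, and every remaining hypothesis is a
decidable inequality between rationals: data `sᵢ ≤ S1ᵢ`, `aᵢ ≤ nᵢ ≤ bᵢ` (the certified enclosures — hypotheses
`hsᵢ haᵢ hbᵢ`, NOT proved here), slacks `2·3.141593·βᵢ(3 + 4g) ≤ δᵢ·L₁`, `2·3.141593·(3/2)(2 + 4g) ≤ ε·L₁`, bracket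
`b₁ + δ₁ < n < a₂ − δ₂`, four corners. Conclusion: SOME translation-invariant state of density EXACTLY `n` has
`e^{src}_{√2 g} ≤ u`. [cite: BachLiebSolovej1994, §2] [cite: BratteliRobinsonI1987, §4.3.1]
[cite: DavisRabinowitz1984, §2.1 eq. (2.1.6)] -/
theorem exists_canonicalClass_sourced_le_of_two_HFBCS_sqrtTwoMul_grids (L₁ : ℕ) [NeZero L₁] (hL₁ : 3 ≤ L₁)
    {U g μ'₁ β₁ μ'₂ β₂ s₁ a₁ b₁ δ₁ s₂ a₂ b₂ δ₂ ε n u : ℚ} (hU : 0 ≤ U) (hg : 0 ≤ g) (hβ₁ : 0 ≤ β₁) (hβ₂ : 0 ≤ β₂)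
    (hs₁ : ((s₁ : ℚ) : ℝ) ≤ (∑ k : TorusSite 2 L₁, Real.sqrt ((torusBand L₁ k - ((μ'₁ : ℚ) : ℝ)) ^ 2 + (4 * (g : ℝ) * dWaveGap k) ^ 2) * Real.tanh (((β₁ : ℚ) : ℝ) * Real.sqrt ((torusBand L₁ k - ((μ'₁ : ℚ) : ℝ)) ^ 2 + (4 * (g : ℝ) * dWaveGap k) ^ 2) / 2)) / (L₁ : ℝ) ^ 2)
    (ha₁ : ((a₁ : ℚ) : ℝ) ≤ (∑ k : TorusSite 2 L₁, (1 - (torusBand L₁ k - ((μ'₁ : ℚ) : ℝ)) * Real.tanh (((β₁ : ℚ) : ℝ) * Real.sqrt ((torusBand L₁ k - ((μ'₁ : ℚ) : ℝ)) ^ 2 + (4 * (g : ℝ) * dWaveGap k) ^ 2) / 2) / Real.sqrt ((torusBand L₁ k - ((μ'₁ : ℚ) : ℝ)) ^ 2 + (4 * (g : ℝ) * dWaveGap k) ^ 2))) / (L₁ : ℝ) ^ 2)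
    (hb₁ : (∑ k : TorusSite 2 L₁, (1 - (torusBand L₁ k - ((μ'₁ : ℚ) : ℝ)) * Real.tanh (((β₁ : ℚ) : ℝ) * Real.sqrt ((torusBand L₁ k - ((μ'₁ : ℚ) : ℝ)) ^ 2 + (4 * (g : ℝ) * dWaveGap k) ^ 2) / 2) / Real.sqrt ((torusBand L₁ k - ((μ'₁ : ℚ) : ℝ)) ^ 2 + (4 * (g : ℝ) * dWaveGap k) ^ 2))) / (L₁ : ℝ) ^ 2 ≤ ((b₁ : ℚ) : ℝ))
    (hδ₁ : 2 * (3141593 / 10 ^ 6 : ℚ) * (β₁ * (3 + 4 * g)) ≤ δ₁ * L₁)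
    (hs₂ : ((s₂ : ℚ) : ℝ) ≤ (∑ k : TorusSite 2 L₁, Real.sqrt ((torusBand L₁ k - ((μ'₂ : ℚ) : ℝ)) ^ 2 + (4 * (g : ℝ) * dWaveGap k) ^ 2) * Real.tanh (((β₂ : ℚ) : ℝ) * Real.sqrt ((torusBand L₁ k - ((μ'₂ : ℚ) : ℝ)) ^ 2 + (4 * (g : ℝ) * dWaveGap k) ^ 2) / 2)) / (L₁ : ℝ) ^ 2)
    (ha₂ : ((a₂ : ℚ) : ℝ) ≤ (∑ k : TorusSite 2 L₁, (1 - (torusBand L₁ k - ((μ'₂ : ℚ) : ℝ)) * Real.tanh (((β₂ : ℚ) : ℝ) * Real.sqrt ((torusBand L₁ k - ((μ'₂ : ℚ) : ℝ)) ^ 2 + (4 * (g : ℝ) * dWaveGap k) ^ 2) / 2) / Real.sqrt ((torusBand L₁ k - ((μ'₂ : ℚ) : ℝ)) ^ 2 + (4 * (g : ℝ) * dWaveGap k) ^ 2))) / (L₁ : ℝ) ^ 2)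
    (hb₂ : (∑ k : TorusSite 2 L₁, (1 - (torusBand L₁ k - ((μ'₂ : ℚ) : ℝ)) * Real.tanh (((β₂ : ℚ) : ℝ) * Real.sqrt ((torusBand L₁ k - ((μ'₂ : ℚ) : ℝ)) ^ 2 + (4 * (g : ℝ) * dWaveGap k) ^ 2) / 2) / Real.sqrt ((torusBand L₁ k - ((μ'₂ : ℚ) : ℝ)) ^ 2 + (4 * (g : ℝ) * dWaveGap k) ^ 2))) / (L₁ : ℝ) ^ 2 ≤ ((b₂ : ℚ) : ℝ))
    (hδ₂ : 2 * (3141593 / 10 ^ 6 : ℚ) * (β₂ * (3 + 4 * g)) ≤ δ₂ * L₁)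
    (hε : 2 * (3141593 / 10 ^ 6 : ℚ) * (3 / 2 * (2 + 4 * g)) ≤ ε * L₁)
    (hlt : b₁ + δ₁ < n) (hgt : n < a₂ - δ₂)
    (hcaa : ((a₂ - δ₂) - n) * ((-s₁ + ε - μ'₁) + μ'₁ * (a₁ - δ₁) + U * (a₁ - δ₁) ^ 2 / 4) +
      (n - (a₁ - δ₁)) * ((-s₂ + ε - μ'₂) + μ'₂ * (a₂ - δ₂) + U * (a₂ - δ₂) ^ 2 / 4) ≤ u * ((a₂ - δ₂) - (a₁ - δ₁)))
    (hcab : ((b₂ + δ₂) - n) * ((-s₁ + ε - μ'₁) + μ'₁ * (a₁ - δ₁) + U * (a₁ - δ₁) ^ 2 / 4) +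
      (n - (a₁ - δ₁)) * ((-s₂ + ε - μ'₂) + μ'₂ * (b₂ + δ₂) + U * (b₂ + δ₂) ^ 2 / 4) ≤ u * ((b₂ + δ₂) - (a₁ - δ₁)))
    (hcba : ((a₂ - δ₂) - n) * ((-s₁ + ε - μ'₁) + μ'₁ * (b₁ + δ₁) + U * (b₁ + δ₁) ^ 2 / 4) +
      (n - (b₁ + δ₁)) * ((-s₂ + ε - μ'₂) + μ'₂ * (a₂ - δ₂) + U * (a₂ - δ₂) ^ 2 / 4) ≤ u * ((a₂ - δ₂) - (b₁ + δ₁)))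
    (hcbb : ((b₂ + δ₂) - n) * ((-s₁ + ε - μ'₁) + μ'₁ * (b₁ + δ₁) + U * (b₁ + δ₁) ^ 2 / 4) +
      (n - (b₁ + δ₁)) * ((-s₂ + ε - μ'₂) + μ'₂ * (b₂ + δ₂) + U * (b₂ + δ₂) ^ 2 / 4) ≤ u * ((b₂ + δ₂) - (b₁ + δ₁))) :
    ∃ σ : InfVolFermionState 2, σ.IsTranslationInvariant ∧ σ.density = ((n : ℚ) : ℝ) ∧
      σ.meanEnergy (hubbardTTPrimeSourcedInteraction 1 0 ((U : ℚ) : ℝ) 0 dWaveFormFactor (Real.sqrt 2 * (g : ℝ))) 1 ≤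
        ((u : ℚ) : ℝ) := by
  have key := exists_canonicalClass_sourced_le_of_two_HFBCS_grids L₁ hL₁ (U := ((U : ℚ) : ℝ)) (by exact_mod_cast hU)
    (Real.sqrt 2 * (g : ℝ)) ((μ'₁ : ℚ) : ℝ) ((β₁ : ℚ) : ℝ) ((μ'₂ : ℚ) : ℝ) ((β₂ : ℚ) : ℝ) (by exact_mod_cast hβ₁)
    (by exact_mod_cast hβ₂) (s₁ := ((s₁ : ℚ) : ℝ)) (a₁ := ((a₁ : ℚ) : ℝ)) (b₁ := ((b₁ : ℚ) : ℝ)) (δ₁ := ((δ₁ : ℚ) : ℝ))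
    (s₂ := ((s₂ : ℚ) : ℝ)) (a₂ := ((a₂ : ℚ) : ℝ)) (b₂ := ((b₂ : ℚ) : ℝ)) (δ₂ := ((δ₂ : ℚ) : ℝ)) (ε := ((ε : ℚ) : ℝ))
    (n := ((n : ℚ) : ℝ)) (u := ((u : ℚ) : ℝ))
  simp only [two_mul_sqrt_two_mul_sqrt_two_mul] at key
  refine key hs₁ ha₁ hb₁ (density_slack_le_of_rat L₁ hg hβ₁ hδ₁) hs₂ ha₂ hb₂ (density_slack_le_of_rat L₁ hg hβ₂ hδ₂)
    (energy_slack_le_of_rat L₁ hg hε) ?_ ?_ ?_ ?_ ?_ ?_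
  · exact_mod_cast hlt
  · exact_mod_cast hgt
  · exact_mod_cast hcaa
  · exact_mod_cast hcab
  · exact_mod_cast hcba
  · exact_mod_cast hcbb

end SqrtTwoGrid

/-! ### §4 The canonical-class RESPONSE FLOOR: `#`-row floor × HF–BCS canonical cap, by name -/

section Floor

variable {ω : InfVolFermionState 2}

/-- **CANONICAL-CLASS FINITE-FIELD RESPONSE FLOOR from a certified source-free floor and two HF–BCS grids** (`t' = 0`,
grid field `h = √2·g`, `g > 0`, `0 < n < 2`, `U ≥ 0`): for every translation-invariant density-`n` minimiser `ω` of the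
sourced mean energy `E_{√2 g}` (an infinite-volume ground state of `H − h(Δ_d + Δ_d†)` at fixed density — print's
comparator class), a certified canonical floor `lo ≤ e(1, 0, U, n)` (a registry row node, e.g. `#507` at `(2, 7/8, 0)`) and
the canonical HF–BCS cap `u` of §3 give `(lo − u)/(2·√2 g) ≤ Re ω(P₀^d)` (`re_expect_localPairAt_ge_of_minimiser`). A
large-field RESPONSE floor, CONDITIONAL on the named row and on the certified momentum sums; never an order parameter.
[cite: Griffiths1966, §II] [cite: KomaTasaki1994, §1] [cite: BachLiebSolovej1994, §2] -/
theorem re_expect_localPairAt_ge_of_minimiser_of_two_HFBCS_sqrtTwoMul_grids (L₁ : ℕ) [NeZero L₁] (hL₁ : 3 ≤ L₁)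
    {U g μ'₁ β₁ μ'₂ β₂ s₁ a₁ b₁ δ₁ s₂ a₂ b₂ δ₂ ε n u lo : ℚ} (hU : 0 ≤ U) (hg : 0 < g) (hβ₁ : 0 ≤ β₁) (hβ₂ : 0 ≤ β₂)
    (hn0 : 0 < n) (hn2 : n < 2) (hω : ω.IsTranslationInvariant) (hρ : ω.density = ((n : ℚ) : ℝ))
    (hmin : ∀ ω' : InfVolFermionState 2, ω'.IsTranslationInvariant → ω'.density = ((n : ℚ) : ℝ) →
      ω.meanEnergy (hubbardTTPrimeSourcedInteraction 1 0 ((U : ℚ) : ℝ) 0 dWaveFormFactor (Real.sqrt 2 * (g : ℝ))) 1 ≤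
        ω'.meanEnergy (hubbardTTPrimeSourcedInteraction 1 0 ((U : ℚ) : ℝ) 0 dWaveFormFactor (Real.sqrt 2 * (g : ℝ))) 1)
    (hlo : ((lo : ℚ) : ℝ) ≤ energyDensityTT' 1 0 ((U : ℚ) : ℝ) ((n : ℚ) : ℝ))
    (hs₁ : ((s₁ : ℚ) : ℝ) ≤ (∑ k : TorusSite 2 L₁, Real.sqrt ((torusBand L₁ k - ((μ'₁ : ℚ) : ℝ)) ^ 2 + (4 * (g : ℝ) * dWaveGap k) ^ 2) * Real.tanh (((β₁ : ℚ) : ℝ) * Real.sqrt ((torusBand L₁ k - ((μ'₁ : ℚ) : ℝ)) ^ 2 + (4 * (g : ℝ) * dWaveGap k) ^ 2) / 2)) / (L₁ : ℝ) ^ 2)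
    (ha₁ : ((a₁ : ℚ) : ℝ) ≤ (∑ k : TorusSite 2 L₁, (1 - (torusBand L₁ k - ((μ'₁ : ℚ) : ℝ)) * Real.tanh (((β₁ : ℚ) : ℝ) * Real.sqrt ((torusBand L₁ k - ((μ'₁ : ℚ) : ℝ)) ^ 2 + (4 * (g : ℝ) * dWaveGap k) ^ 2) / 2) / Real.sqrt ((torusBand L₁ k - ((μ'₁ : ℚ) : ℝ)) ^ 2 + (4 * (g : ℝ) * dWaveGap k) ^ 2))) / (L₁ : ℝ) ^ 2)
    (hb₁ : (∑ k : TorusSite 2 L₁, (1 - (torusBand L₁ k - ((μ'₁ : ℚ) : ℝ)) * Real.tanh (((β₁ : ℚ) : ℝ) * Real.sqrt ((torusBand L₁ k - ((μ'₁ : ℚ) : ℝ)) ^ 2 + (4 * (g : ℝ) * dWaveGap k) ^ 2) / 2) / Real.sqrt ((torusBand L₁ k - ((μ'₁ : ℚ) : ℝ)) ^ 2 + (4 * (g : ℝ) * dWaveGap k) ^ 2))) / (L₁ : ℝ) ^ 2 ≤ ((b₁ : ℚ) : ℝ))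
    (hδ₁ : 2 * (3141593 / 10 ^ 6 : ℚ) * (β₁ * (3 + 4 * g)) ≤ δ₁ * L₁)
    (hs₂ : ((s₂ : ℚ) : ℝ) ≤ (∑ k : TorusSite 2 L₁, Real.sqrt ((torusBand L₁ k - ((μ'₂ : ℚ) : ℝ)) ^ 2 + (4 * (g : ℝ) * dWaveGap k) ^ 2) * Real.tanh (((β₂ : ℚ) : ℝ) * Real.sqrt ((torusBand L₁ k - ((μ'₂ : ℚ) : ℝ)) ^ 2 + (4 * (g : ℝ) * dWaveGap k) ^ 2) / 2)) / (L₁ : ℝ) ^ 2)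
    (ha₂ : ((a₂ : ℚ) : ℝ) ≤ (∑ k : TorusSite 2 L₁, (1 - (torusBand L₁ k - ((μ'₂ : ℚ) : ℝ)) * Real.tanh (((β₂ : ℚ) : ℝ) * Real.sqrt ((torusBand L₁ k - ((μ'₂ : ℚ) : ℝ)) ^ 2 + (4 * (g : ℝ) * dWaveGap k) ^ 2) / 2) / Real.sqrt ((torusBand L₁ k - ((μ'₂ : ℚ) : ℝ)) ^ 2 + (4 * (g : ℝ) * dWaveGap k) ^ 2))) / (L₁ : ℝ) ^ 2)
    (hb₂ : (∑ k : TorusSite 2 L₁, (1 - (torusBand L₁ k - ((μ'₂ : ℚ) : ℝ)) * Real.tanh (((β₂ : ℚ) : ℝ) * Real.sqrt ((torusBand L₁ k - ((μ'₂ : ℚ) : ℝ)) ^ 2 + (4 * (g : ℝ) * dWaveGap k) ^ 2) / 2) / Real.sqrt ((torusBand L₁ k - ((μ'₂ : ℚ) : ℝ)) ^ 2 + (4 * (g : ℝ) * dWaveGap k) ^ 2))) / (L₁ : ℝ) ^ 2 ≤ ((b₂ : ℚ) : ℝ))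
    (hδ₂ : 2 * (3141593 / 10 ^ 6 : ℚ) * (β₂ * (3 + 4 * g)) ≤ δ₂ * L₁)
    (hε : 2 * (3141593 / 10 ^ 6 : ℚ) * (3 / 2 * (2 + 4 * g)) ≤ ε * L₁)
    (hlt : b₁ + δ₁ < n) (hgt : n < a₂ - δ₂)
    (hcaa : ((a₂ - δ₂) - n) * ((-s₁ + ε - μ'₁) + μ'₁ * (a₁ - δ₁) + U * (a₁ - δ₁) ^ 2 / 4) +
      (n - (a₁ - δ₁)) * ((-s₂ + ε - μ'₂) + μ'₂ * (a₂ - δ₂) + U * (a₂ - δ₂) ^ 2 / 4) ≤ u * ((a₂ - δ₂) - (a₁ - δ₁)))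
    (hcab : ((b₂ + δ₂) - n) * ((-s₁ + ε - μ'₁) + μ'₁ * (a₁ - δ₁) + U * (a₁ - δ₁) ^ 2 / 4) +
      (n - (a₁ - δ₁)) * ((-s₂ + ε - μ'₂) + μ'₂ * (b₂ + δ₂) + U * (b₂ + δ₂) ^ 2 / 4) ≤ u * ((b₂ + δ₂) - (a₁ - δ₁)))
    (hcba : ((a₂ - δ₂) - n) * ((-s₁ + ε - μ'₁) + μ'₁ * (b₁ + δ₁) + U * (b₁ + δ₁) ^ 2 / 4) +
      (n - (b₁ + δ₁)) * ((-s₂ + ε - μ'₂) + μ'₂ * (a₂ - δ₂) + U * (a₂ - δ₂) ^ 2 / 4) ≤ u * ((a₂ - δ₂) - (b₁ + δ₁)))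
    (hcbb : ((b₂ + δ₂) - n) * ((-s₁ + ε - μ'₁) + μ'₁ * (b₁ + δ₁) + U * (b₁ + δ₁) ^ 2 / 4) +
      (n - (b₁ + δ₁)) * ((-s₂ + ε - μ'₂) + μ'₂ * (b₂ + δ₂) + U * (b₂ + δ₂) ^ 2 / 4) ≤ u * ((b₂ + δ₂) - (b₁ + δ₁))) :
    (((lo : ℚ) : ℝ) - ((u : ℚ) : ℝ)) / (2 * (Real.sqrt 2 * (g : ℝ))) ≤
      (ω.expect (pairRegion (insert 0 unitSteps) 0) (localPairAt (insert 0 unitSteps) dWaveFormFactor 0)).re :=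
  re_expect_localPairAt_ge_of_minimiser hω (by exact_mod_cast hU) hρ (by exact_mod_cast hn0) (by exact_mod_cast hn2)
    (sqrt_two_mul_ratCast_pos hg) hlo hmin
    (exists_canonicalClass_sourced_le_of_two_HFBCS_sqrtTwoMul_grids L₁ hL₁ hU hg.le hβ₁ hβ₂ hs₁ ha₁ hb₁ hδ₁ hs₂ ha₂ hb₂
      hδ₂ hε hlt hgt hcaa hcab hcba hcbb)

/-- **Rational SLOT form**: under the same hypotheses, every rational `m` with `0 ≤ lo − u` and `8 g² m² ≤ (lo − u)²`
(`norm_num`) satisfies `m ≤ Re ω(P₀^d)`. [cite: Griffiths1966, §II] [cite: KomaTasaki1994, §1] -/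
theorem ratCast_le_re_expect_localPairAt_of_minimiser_of_two_HFBCS_sqrtTwoMul_grids (L₁ : ℕ) [NeZero L₁]
    (hL₁ : 3 ≤ L₁) {U g μ'₁ β₁ μ'₂ β₂ s₁ a₁ b₁ δ₁ s₂ a₂ b₂ δ₂ ε n u lo m : ℚ} (hU : 0 ≤ U) (hg : 0 < g) (hβ₁ : 0 ≤ β₁)
    (hβ₂ : 0 ≤ β₂) (hn0 : 0 < n) (hn2 : n < 2) (hω : ω.IsTranslationInvariant) (hρ : ω.density = ((n : ℚ) : ℝ))
    (hmin : ∀ ω' : InfVolFermionState 2, ω'.IsTranslationInvariant → ω'.density = ((n : ℚ) : ℝ) →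
      ω.meanEnergy (hubbardTTPrimeSourcedInteraction 1 0 ((U : ℚ) : ℝ) 0 dWaveFormFactor (Real.sqrt 2 * (g : ℝ))) 1 ≤
        ω'.meanEnergy (hubbardTTPrimeSourcedInteraction 1 0 ((U : ℚ) : ℝ) 0 dWaveFormFactor (Real.sqrt 2 * (g : ℝ))) 1)
    (hlo : ((lo : ℚ) : ℝ) ≤ energyDensityTT' 1 0 ((U : ℚ) : ℝ) ((n : ℚ) : ℝ))
    (hs₁ : ((s₁ : ℚ) : ℝ) ≤ (∑ k : TorusSite 2 L₁, Real.sqrt ((torusBand L₁ k - ((μ'₁ : ℚ) : ℝ)) ^ 2 + (4 * (g : ℝ) * dWaveGap k) ^ 2) * Real.tanh (((β₁ : ℚ) : ℝ) * Real.sqrt ((torusBand L₁ k - ((μ'₁ : ℚ) : ℝ)) ^ 2 + (4 * (g : ℝ) * dWaveGap k) ^ 2) / 2)) / (L₁ : ℝ) ^ 2)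
    (ha₁ : ((a₁ : ℚ) : ℝ) ≤ (∑ k : TorusSite 2 L₁, (1 - (torusBand L₁ k - ((μ'₁ : ℚ) : ℝ)) * Real.tanh (((β₁ : ℚ) : ℝ) * Real.sqrt ((torusBand L₁ k - ((μ'₁ : ℚ) : ℝ)) ^ 2 + (4 * (g : ℝ) * dWaveGap k) ^ 2) / 2) / Real.sqrt ((torusBand L₁ k - ((μ'₁ : ℚ) : ℝ)) ^ 2 + (4 * (g : ℝ) * dWaveGap k) ^ 2))) / (L₁ : ℝ) ^ 2)
    (hb₁ : (∑ k : TorusSite 2 L₁, (1 - (torusBand L₁ k - ((μ'₁ : ℚ) : ℝ)) * Real.tanh (((β₁ : ℚ) : ℝ) * Real.sqrt ((torusBand L₁ k - ((μ'₁ : ℚ) : ℝ)) ^ 2 + (4 * (g : ℝ) * dWaveGap k) ^ 2) / 2) / Real.sqrt ((torusBand L₁ k - ((μ'₁ : ℚ) : ℝ)) ^ 2 + (4 * (g : ℝ) * dWaveGap k) ^ 2))) / (L₁ : ℝ) ^ 2 ≤ ((b₁ : ℚ) : ℝ))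
    (hδ₁ : 2 * (3141593 / 10 ^ 6 : ℚ) * (β₁ * (3 + 4 * g)) ≤ δ₁ * L₁)
    (hs₂ : ((s₂ : ℚ) : ℝ) ≤ (∑ k : TorusSite 2 L₁, Real.sqrt ((torusBand L₁ k - ((μ'₂ : ℚ) : ℝ)) ^ 2 + (4 * (g : ℝ) * dWaveGap k) ^ 2) * Real.tanh (((β₂ : ℚ) : ℝ) * Real.sqrt ((torusBand L₁ k - ((μ'₂ : ℚ) : ℝ)) ^ 2 + (4 * (g : ℝ) * dWaveGap k) ^ 2) / 2)) / (L₁ : ℝ) ^ 2)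
    (ha₂ : ((a₂ : ℚ) : ℝ) ≤ (∑ k : TorusSite 2 L₁, (1 - (torusBand L₁ k - ((μ'₂ : ℚ) : ℝ)) * Real.tanh (((β₂ : ℚ) : ℝ) * Real.sqrt ((torusBand L₁ k - ((μ'₂ : ℚ) : ℝ)) ^ 2 + (4 * (g : ℝ) * dWaveGap k) ^ 2) / 2) / Real.sqrt ((torusBand L₁ k - ((μ'₂ : ℚ) : ℝ)) ^ 2 + (4 * (g : ℝ) * dWaveGap k) ^ 2))) / (L₁ : ℝ) ^ 2)
    (hb₂ : (∑ k : TorusSite 2 L₁, (1 - (torusBand L₁ k - ((μ'₂ : ℚ) : ℝ)) * Real.tanh (((β₂ : ℚ) : ℝ) * Real.sqrt ((torusBand L₁ k - ((μ'₂ : ℚ) : ℝ)) ^ 2 + (4 * (g : ℝ) * dWaveGap k) ^ 2) / 2) / Real.sqrt ((torusBand L₁ k - ((μ'₂ : ℚ) : ℝ)) ^ 2 + (4 * (g : ℝ) * dWaveGap k) ^ 2))) / (L₁ : ℝ) ^ 2 ≤ ((b₂ : ℚ) : ℝ))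
    (hδ₂ : 2 * (3141593 / 10 ^ 6 : ℚ) * (β₂ * (3 + 4 * g)) ≤ δ₂ * L₁)
    (hε : 2 * (3141593 / 10 ^ 6 : ℚ) * (3 / 2 * (2 + 4 * g)) ≤ ε * L₁)
    (hlt : b₁ + δ₁ < n) (hgt : n < a₂ - δ₂)
    (hcaa : ((a₂ - δ₂) - n) * ((-s₁ + ε - μ'₁) + μ'₁ * (a₁ - δ₁) + U * (a₁ - δ₁) ^ 2 / 4) +
      (n - (a₁ - δ₁)) * ((-s₂ + ε - μ'₂) + μ'₂ * (a₂ - δ₂) + U * (a₂ - δ₂) ^ 2 / 4) ≤ u * ((a₂ - δ₂) - (a₁ - δ₁)))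
    (hcab : ((b₂ + δ₂) - n) * ((-s₁ + ε - μ'₁) + μ'₁ * (a₁ - δ₁) + U * (a₁ - δ₁) ^ 2 / 4) +
      (n - (a₁ - δ₁)) * ((-s₂ + ε - μ'₂) + μ'₂ * (b₂ + δ₂) + U * (b₂ + δ₂) ^ 2 / 4) ≤ u * ((b₂ + δ₂) - (a₁ - δ₁)))
    (hcba : ((a₂ - δ₂) - n) * ((-s₁ + ε - μ'₁) + μ'₁ * (b₁ + δ₁) + U * (b₁ + δ₁) ^ 2 / 4) +
      (n - (b₁ + δ₁)) * ((-s₂ + ε - μ'₂) + μ'₂ * (a₂ - δ₂) + U * (a₂ - δ₂) ^ 2 / 4) ≤ u * ((a₂ - δ₂) - (b₁ + δ₁)))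
    (hcbb : ((b₂ + δ₂) - n) * ((-s₁ + ε - μ'₁) + μ'₁ * (b₁ + δ₁) + U * (b₁ + δ₁) ^ 2 / 4) +
      (n - (b₁ + δ₁)) * ((-s₂ + ε - μ'₂) + μ'₂ * (b₂ + δ₂) + U * (b₂ + δ₂) ^ 2 / 4) ≤ u * ((b₂ + δ₂) - (b₁ + δ₁)))
    (hsl : 0 ≤ lo - u) (hm : 8 * g ^ 2 * m ^ 2 ≤ (lo - u) ^ 2) :
    ((m : ℚ) : ℝ) ≤
      (ω.expect (pairRegion (insert 0 unitSteps) 0) (localPairAt (insert 0 unitSteps) dWaveFormFactor 0)).re := by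
  have hfl := re_expect_localPairAt_ge_of_minimiser_of_two_HFBCS_sqrtTwoMul_grids L₁ hL₁ hU hg hβ₁ hβ₂ hn0 hn2 hω hρ hmin
    hlo hs₁ ha₁ hb₁ hδ₁ hs₂ ha₂ hb₂ hδ₂ hε hlt hgt hcaa hcab hcba hcbb
  have hpos : (0 : ℝ) < 2 * (Real.sqrt 2 * (g : ℝ)) := by have := sqrt_two_mul_ratCast_pos hg; positivity
  have hstep := ratCast_mul_two_sqrtTwoMul_le hsl hm
  rw [sub_zero] at hstep
  have : ((m : ℚ) : ℝ) ≤ (((lo : ℚ) : ℝ) - ((u : ℚ) : ℝ)) / (2 * (Real.sqrt 2 * (g : ℝ))) := by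
    rw [le_div_iff₀ hpos]
    push_cast at hstep ⊢
    exact hstep
  exact this.trans hfl

end Floor

end Summit.Ventures.CertifiedManyBodySolver.Observables

end
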